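import Literature.NumberTheory.EllipticCurves.PAdicTwoVariableInverseTransform
import Literature.NumberTheory.EllipticCurves.DeShalit1987.KatzMeasureFromDistribution
import HarnessLib

/-!
# de Shalit 1987, II.4.17 (54) with (49): from the two-variable Katz frame `IsKatzMeasure₂` BACK to a
# bounded distribution on the `ℤ_p²`-tower — the frame and the integral form (49)–(50) are EQUIVALENT
# (all PROVED; no named fact)

Sequel of `KatzMeasureFromDistribution.lean` (distribution with de Shalit's integrals ⟹ frame, via the
two-variable Amice transform `amice₂Int`) using the INVERSE transform of
`PAdicTwoVariableInverseTransform.lean` (`invAmice₂`: power series with bounded coefficients ⟹ bounded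
distribution with that transform). For an integral two-variable series
`G ∈ 𝒪_{ℂ_p}⟦T₁⟧⟦T₂⟧` we form the distribution `IntSeries.toDistribution₂ G` of norm `≤ 1` on `ℤ_p²`
(§1: `amice₂Int (toDistribution₂ G) = G`, and `G(F(1,0) − 1, F(0,1) − 1) = ∫ F d(toDistribution₂ G)` for
every continuous character `F`), and prove (§2):

* `IsKatzMeasure₂.isKatzDistribution₂_toDistribution₂` — a `λ`-frame `G` for `(κ₁, κ₂; γ₁, γ₂)` yields a
  distribution with de Shalit's integrals (49)–(50) for `(κ₁, κ₂)` (`DeShalit1987.IsKatzDistribution₂`);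
* `IsKatzMeasure₂.isKatzDistribution₂_of_inv` — the same from a frame READ AT THE INVERSE GENERATORS
  `(γ₁⁻¹, γ₂⁻¹)` (the `bsd-print-cf2` crux shape), via the reflected distribution;
* `DeShalit1987.exists_isKatzMeasure₂_iff_exists_isKatzDistribution₂` (and `_inv_iff_`) — **at a
  generator pair, «some power series is a Katz frame» ⟺ «some bounded distribution of norm `≤ 1` has
  de Shalit's integrals»**: the power-series currency of the tree's frames and the measure currency of
  de Shalit's (49) carry exactly the same information. In particular the named fact
  `DeShalit1987.thmII417_exists_katzSheet` and the analytic stub `MeasureExists` of the `bsd-print-cf2`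
  crux `TwoVariableMainConjAtSplitTwo` are statements about the EXISTENCE OF A MEASURE, with no
  power-series content left.

## References

* [deShalit1987] E. de Shalit, *Iwasawa theory of elliptic curves with complex multiplication*,
  Perspectives in Math. 3 (1987): I.3.1–3.4 (p. 13–15), II.4.16 (49)–(50) (p. 76–77), II.4.17 (54) (p. 78).
* [Rubin1991] K. Rubin, Invent. Math. 103 (1991), §4.
-/

noncomputable section

open Filter Topology
open NumberField IsDedekindDomain Field
open Literature.NumberTheory.GaloisRepresentations

namespace Literature.NumberTheory.EllipticCurves

variable {p : ℕ} [Fact p.Prime]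

/-! ### §1. The distribution of an integral two-variable series -/

namespace IntSeries

variable (G : PowerSeries (PowerSeries (PadicComplexInt p)))

/-- An integral series read with `ℂ_p`-coefficients. [cite: deShalit1987, I.3.3 (p. 14)] -/
def toComplex₂ : PowerSeries (PowerSeries ℂ_[p]) :=
  PowerSeries.map (PowerSeries.map (PadicComplexInt p).subtype) G

/-- The coefficients of `toComplex₂ G` are those of `G`. [cite: deShalit1987, I.3.3 (p. 14)] -/
@[simp] theorem coeff_coeff_toComplex₂ (i j : ℕ) :
    PowerSeries.coeff j (PowerSeries.coeff i (toComplex₂ G)) =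
      ((PowerSeries.coeff j (PowerSeries.coeff i G) : PadicComplexInt p) : ℂ_[p]) := by
  rw [toComplex₂, PowerSeries.coeff_map, PowerSeries.coeff_map]
  rfl

/-- The coefficients of an integral series have norm `≤ 1`. [cite: deShalit1987, I.3.3 (p. 14)] -/
theorem norm_coeff_coeff_toComplex₂_le (i j : ℕ) :
    ‖PowerSeries.coeff j (PowerSeries.coeff i (toComplex₂ G))‖ ≤ 1 := by
  rw [coeff_coeff_toComplex₂]
  exact norm_coe_padicComplexInt_le_one _

variable (p) in
/-- **The bounded `ℂ_p`-valued distribution on `ℤ_p²` of an integral two-variable series** `G`: the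
inverse Amice transform `invAmice₂` of `G` (de Shalit I.3.3: the measure of a power series), of norm
`≤ 1`. [cite: deShalit1987, I.3.1–3.3 (p. 13–14)] -/
def toDistribution₂ : BoundedDistribution (padicIntSq p) ℂ_[p] :=
  invAmice₂ p (toComplex₂ G) (norm_coeff_coeff_toComplex₂_le G)

/-- The distribution of an integral series has norm `≤ 1`. [cite: deShalit1987, I.3.3 (p. 14)] -/
theorem toDistribution₂_bound_le : (toDistribution₂ p G).bound ≤ 1 := le_rfl

/-- **`amice₂Int ∘ toDistribution₂ = id`** on integral series (the inversion theorem
`amice₂_invAmice₂` in the integral receptacle). [cite: deShalit1987, I.3.3 (p. 14)] -/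
theorem amice₂Int_toDistribution₂ :
    (toDistribution₂ p G).amice₂Int (toDistribution₂_bound_le G) = G := by
  ext i j
  rw [BoundedDistribution.coe_coeff_coeff_amice₂Int, toDistribution₂, amice₂_invAmice₂,
    coeff_coeff_toComplex₂]

/-- **`G(F(1,0) − 1, F(0,1) − 1) = ∫ F d(toDistribution₂ G)`** for every continuous character `F` of
`ℤ_p²` with principal-unit values (`IntSeries.HasValueAt₂`). [cite: deShalit1987, I.3.3 (p. 14), II.4.17 (52)–(54) (p. 77–78)] -/
theorem hasValueAt₂_integral_toDistribution₂ {F : ℤ_[p] × ℤ_[p] → ℂ_[p]} (hF : IsContinuousChar₂ F) :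
    IntSeries.HasValueAt₂ G (F (1, 0) - 1) (F (0, 1) - 1) ((toDistribution₂ p G).integral F) := by
  have h := (toDistribution₂ p G).hasValueAt₂_amice₂Int (toDistribution₂_bound_le G) hF
  rwa [amice₂Int_toDistribution₂] at h

end IntSeries

/-! ### §2. Frame ⟹ distribution, and the equivalence -/

section Katz

variable {K : Type} [Field K] [NumberField K]
  {ι : PadicAlgCl p ≃+* ℂ} {v vbar : HeightOneSpectrum (𝓞 K)} {S : Finset (HeightOneSpectrum (𝓞 K))}
  {κ₁ κ₂ : ZpExtension K p} {γ₁ γ₂ : absoluteGaloisGroup K} {lam : HeckeCharacter K} {Ω δ : ℂ} {Ωp : ℂ_[p]}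

/-- **A Katz frame yields a distribution with de Shalit's integrals.** If `G ∈ 𝒪_{ℂ_p}⟦T₁⟧⟦T₂⟧` satisfies
`IsKatzMeasure₂ ι v v̄ S κ₁ κ₂ γ₁ γ₂ λ Ω δ Ω_p G` at a generator pair `(γ₁, γ₂)`, then its distribution
`toDistribution₂ G` satisfies `IsKatzDistribution₂ ι v v̄ S κ₁ κ₂ λ Ω δ Ω_p`: at a range point `(ρ, r)` the
test function `F` IS the descent `pairChar r` (uniqueness), a continuous character with
`F(1,0) = r(γ₁)`, `F(0,1) = r(γ₂)`, so `∫ F = G(r(γ₁) − 1, r(γ₂) − 1)` (§1) `=` the prescribed value (the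
frame), by uniqueness of values. [cite: deShalit1987, II.4.16 (49)–(50) (p. 76–77), II.4.17 (54) (p. 78)] -/
theorem IsKatzMeasure₂.isKatzDistribution₂_toDistribution₂ {G : PowerSeries (PowerSeries (PadicComplexInt p))}
    (hG : IsKatzMeasure₂ ι v vbar S κ₁ κ₂ γ₁ γ₂ lam Ω δ Ωp G) (hγ : ZpExtension.IsTopGeneratorPair κ₁ κ₂ γ₁ γ₂) :
    DeShalit1987.IsKatzDistribution₂ ι v vbar S κ₁ κ₂ lam Ω δ Ωp (IntSeries.toDistribution₂ p G) := by
  intro ρ r m j hr hκ hjm hinf hunr hL F hF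
  have h : κ₁.IsIndependent κ₂ := hγ.isIndependent
  have hFeq : F = ZpExtension.pairChar h r := ZpExtension.eq_pairChar_of_forall_apply_pairCoord h hκ hF
  have hchar : IsContinuousChar₂ (ZpExtension.pairChar h r) := ZpExtension.isContinuousChar₂_pairChar hκ hγ h
  have hval := IntSeries.hasValueAt₂_integral_toDistribution₂ G hchar
  rw [ZpExtension.pairChar_one_zero hκ hγ h, ZpExtension.pairChar_zero_one hκ hγ h] at hval
  rw [hFeq]
  exact hval.unique (hG.hasValueAt₂ hr hκ hjm hinf hunr hL)

omit [NumberField K] in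
/-- Twisting twice by `−1` gives back the `ℤ_p`-extension. [cite: deShalit1987, II.4.17 (54) (p. 78)] -/
theorem ZpExtension.unitTwist_neg_one_unitTwist_neg_one (κ : ZpExtension K p) :
    (κ.unitTwist (-1)).unitTwist (-1) = κ := by
  apply DFunLike.ext
  intro σ
  rw [ZpExtension.unitTwist_apply, ZpExtension.unitTwist_apply, toAdd_ofAdd]
  simp

/-- **A frame READ AT THE INVERSE GENERATORS yields a distribution with de Shalit's integrals for the
ORIGINAL pair**: if `IsKatzMeasure₂ ι v v̄ S κ₁ κ₂ γ₁⁻¹ γ₂⁻¹ λ Ω δ Ω_p G` with `(γ₁, γ₂)` a generator pair for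
`(κ₁, κ₂)` (the shape of the `bsd-print-cf2` crux `TwoVariableMainConjAtSplitTwo`), then the REFLECTED
distribution `(toDistribution₂ G)·(−1)` satisfies `IsKatzDistribution₂ ι v v̄ S κ₁ κ₂ λ Ω δ Ω_p` (read the
frame as one at the generators `(γ₁⁻¹, γ₂⁻¹)` of the `(−1)`-twisted pair, pass to its distribution, and
reflect back). [cite: deShalit1987, II.4.17 (54) (p. 78)] -/
theorem IsKatzMeasure₂.isKatzDistribution₂_of_inv {G : PowerSeries (PowerSeries (PadicComplexInt p))}
    (hG : IsKatzMeasure₂ ι v vbar S κ₁ κ₂ γ₁⁻¹ γ₂⁻¹ lam Ω δ Ωp G)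
    (hγ : ZpExtension.IsTopGeneratorPair κ₁ κ₂ γ₁ γ₂) :
    DeShalit1987.IsKatzDistribution₂ ι v vbar S κ₁ κ₂ lam Ω δ Ωp
      ((IntSeries.toDistribution₂ p G).linearMap (-1) 0 0 (-1)) := by
  have hG' : IsKatzMeasure₂ ι v vbar S (κ₁.unitTwist (-1)) (κ₂.unitTwist (-1)) γ₁⁻¹ γ₂⁻¹ lam Ω δ Ωp G :=
    (isKatzMeasure₂_unitTwist_iff (-1) (-1)).mpr hG
  have hD := hG'.isKatzDistribution₂_toDistribution₂ hγ.unitTwist_neg_one_inv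
  have h := hD.linearMap_neg_one hγ.unitTwist_neg_one_inv.isIndependent
  rwa [ZpExtension.unitTwist_neg_one_unitTwist_neg_one, ZpExtension.unitTwist_neg_one_unitTwist_neg_one] at h

/-- **Equivalence at a generator pair**: «some `G ∈ 𝒪_{ℂ_p}⟦T₁⟧⟦T₂⟧` is a `λ`-frame for `(κ₁, κ₂; γ₁, γ₂)`»
⟺ «some bounded `ℂ_p`-distribution of norm `≤ 1` on `ℤ_p²` has de Shalit's integrals (49)–(50) for
`(κ₁, κ₂)`» — the frame is the Amice transform of the distribution and the distribution is the inverse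
transform of the frame. [cite: deShalit1987, II.4.16 (49)–(50) (p. 76–77), II.4.17 (54) (p. 78)] -/
theorem DeShalit1987.exists_isKatzMeasure₂_iff_exists_isKatzDistribution₂
    (hγ : ZpExtension.IsTopGeneratorPair κ₁ κ₂ γ₁ γ₂) :
    (∃ G, IsKatzMeasure₂ ι v vbar S κ₁ κ₂ γ₁ γ₂ lam Ω δ Ωp G) ↔
      ∃ D : BoundedDistribution (padicIntSq p) ℂ_[p], D.bound ≤ 1 ∧
        DeShalit1987.IsKatzDistribution₂ ι v vbar S κ₁ κ₂ lam Ω δ Ωp D :=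
  ⟨fun ⟨_, hG⟩ ↦ ⟨_, IntSeries.toDistribution₂_bound_le _, hG.isKatzDistribution₂_toDistribution₂ hγ⟩,
    fun ⟨_, hD, hμ⟩ ↦ ⟨_, hμ.isKatzMeasure₂_amice₂Int hD hγ⟩⟩

/-- **Equivalence, inverse-generator form** (the crux shape): «some `G` is a `λ`-frame at
`(γ₁⁻¹, γ₂⁻¹)`» ⟺ «some bounded distribution of norm `≤ 1` has de Shalit's integrals for `(κ₁, κ₂)`».
[cite: deShalit1987, II.4.17 (54) (p. 78)] -/
theorem DeShalit1987.exists_isKatzMeasure₂_inv_iff_exists_isKatzDistribution₂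
    (hγ : ZpExtension.IsTopGeneratorPair κ₁ κ₂ γ₁ γ₂) :
    (∃ G, IsKatzMeasure₂ ι v vbar S κ₁ κ₂ γ₁⁻¹ γ₂⁻¹ lam Ω δ Ωp G) ↔
      ∃ D : BoundedDistribution (padicIntSq p) ℂ_[p], D.bound ≤ 1 ∧
        DeShalit1987.IsKatzDistribution₂ ι v vbar S κ₁ κ₂ lam Ω δ Ωp D :=
  ⟨fun ⟨G, hG⟩ ↦ ⟨_, BoundedDistribution.linearMap_neg_one_bound_le (IntSeries.toDistribution₂_bound_le G),
      hG.isKatzDistribution₂_of_inv hγ⟩,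
    fun ⟨_, hD, hμ⟩ ↦ ⟨_, hμ.isKatzMeasure₂_amice₂Int_inv hD hγ⟩⟩

/-- **Equivalence in the `IsKatzSheet` receptacle** (`MvPowerSeries (Fin 2)`), for an independent pair with
dual basis. [cite: deShalit1987, II.4.17 (54) (p. 78)] -/
theorem DeShalit1987.exists_isKatzSheet_iff_exists_isKatzDistribution₂ (hγ : κ₁.IsDualBasis κ₂ γ₁ γ₂) :
    (∃ M, DeShalit1987.IsKatzSheet ι v vbar S κ₁ κ₂ γ₁ γ₂ lam Ω δ Ωp M) ↔
      ∃ D : BoundedDistribution (padicIntSq p) ℂ_[p], D.bound ≤ 1 ∧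
        DeShalit1987.IsKatzDistribution₂ ι v vbar S κ₁ κ₂ lam Ω δ Ωp D := by
  rw [DeShalit1987.exists_isKatzSheet_iff_exists_isKatzMeasure₂]
  exact DeShalit1987.exists_isKatzMeasure₂_iff_exists_isKatzDistribution₂
    (ZpExtension.isDualBasis_iff_isTopGeneratorPair.mp hγ)

end Katz

end Literature.NumberTheory.EllipticCurves

end
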